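import Mathlib.CategoryTheory.Limits.Shapes.Pullback.PullbackCone
import Mathlib.CategoryTheory.Limits.Shapes.Equalizers
import Literature.AnabelianGeometry.SemiGraphs.QuasiTemperoids
import Literature.AnabelianGeometry.SemiGraphs.GaloisCountable
import HarnessLib

/-!
# Semi-graphs of anabelioids, Appendix: quasi-temperoids (part 2: Definition A.3, Remark A.3.1,
# Theorem A.4, Remarks A.4.1–A.4.2)

Mochizuki, *Semi-graphs of anabelioids*, Publ. RIMS **42** (2006) 221–322, Appendix
"Quasi-temperoids", author's manuscript pp. 81–86 [cite: MochizukiSemiAnbd2006, Appendix pp.81-86]: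
the reconstruction of a connected temperoid `T` from the connected quasi-temperoid `T[A]`
("Given the abstract category `T[A]`, is it possible to reconstruct the category `T`
category-theoretically from `T[A]`?", p. 79) via quotient data.

* Definition A.3 (i) *QD-pairs* `(A, Γ_A ⊆ Aut_Q(A))` (`QDPair`), *weakly / strongly connected*
  QD-pairs; (ii) morphisms of QD-pairs (`QDPair.Hom`; they form the category `D` of the proof of
  Thm. A.4, an instance), *0-proper* ones, the *associated group
  homomorphism* `Γ_A → Γ_B` (`QDPair.Hom.assocHom`, defined when the arrow is an epimorphism —
  which is what makes `γ_B` unique; that 0-proper arrows are epimorphisms is Remark A.3.1);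
  (iii) *quotients* `B ≅ A/Γ_A` of QD-pairs (`QDPair.IsQuotient`) with the bracketed claims
  (uniqueness PROVED, `QDPair.IsQuotient.nonempty_iso`; "connected iff weakly connected" the named
  fact `QuotientConnectedIffWeaklyConnected`); (iv) *1-proper* morphisms (`QDPair.Hom.IsOneProper`,
  choice-free: "`Γ_A → Γ_B` surjective" as "every `γ_B` has a `γ_A` over it" and
  `Ker(Γ_A ↠ Γ_B)` as the subgroup of `γ_A` with `γ_A ≫ φ = φ`), with the bracketed composition
  claim as the named fact `OneProperCompQuotient`;
* the set `π₀(A)` of connected components enters only through "`Γ_A` acts transitively on `π₀(A)`"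
  and "`φ` induces a surjection `π₀(A) ↠ π₀(B)`", both rendered over *components* = coprojections
  `C → A` from connected objects (`IsComponent`), so that no quotient set has to be chosen;
* Remark A.3.1 ((a) 0-proper ⟺ (b) epimorphism ⟺ (c) `B = colim(A ×_B A ⇉ A)`) as the named fact
  `RmkA31`;
* Theorem A.4 (connected quasi-temperoids) as the named fact `ThmA4`: for `Q_i := T_i[A_i]` with
  the natural functors `λ_i : Q_i → T_i` (the inclusions), every morphism of quasi-temperoids
  `φ : Q₁ → Q₂` fits into a 1-commutative square `λ₁ ∘ φ^* ≅ ψ^* ∘ λ₂` for a morphism of temperoids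
  `ψ : T₁ → T₂`, unique up to unique isomorphism (this is the square the printed proof p. 85
  produces: `Q_i → D_i → P_i ≅ T_i` under `φ^*`).

Also typed here (author's Comments on [SemiAnbd], May 2020, item (12.) (i) (T1)): *Galois-countable*
(connected) quasi-temperoids (`IsGaloisCountableConnectedQuasiTemperoid`,
`IsGaloisCountableQuasiTemperoid`: they arise from Galois-countable, i.e. second countable, tempered
groups — the tree's `IsGaloisCountable`); by item (12.) (ii) (E6) of loc. cit. ("there is no effect
on … the Appendix, since tempered fundamental groups are never discussed" there) NO statement of the
Appendix acquires a Galois-countability hypothesis, and none is added here.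

Remark A.4.1 ("Theorem A.4 serves, in effect, to reduce the theory of arbitrary connected
quasi-temperoids to the theory of connected temperoids") is expository; Remark A.4.2 (replacing
"temperoid"/"countable" by "anabelioid"/"finite" gives "an entirely analogous [but, in fact,
slightly easier] theory of quasi-anabelioids … We leave the routine details to the reader") is
recorded here and not typed. The last sentences of Remark A.3.1 ("the notion of a quotient … may
also be stated in terms of colimits … 1-proper may be stated entirely in terms of colimits") are
a reformulation remark, recorded not typed. No statement of the paper is strengthened; typed ≠
discharged.
-/

open CategoryTheory CategoryTheory.Limits

namespace Literature.AnabelianGeometry.SemiGraphs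

open Literature.AlgebraicGeometry.Frobenioids (IsConnectedObj IsNonemptyObj)
open Literature.AlgebraicGeometry.Frobenioids.QuasiTemperoid (IsConnectedQuasiTemperoid)

universe v₁ v₂ u u₁ u₂

/-! ### Components of an object (for `π₀(A)`) -/

section Components

variable {Q : Type u₁} [Category.{v₁} Q]

/-- `ι : C → A` *is a connected component of `A`*: `C` is connected and `ι` is a coprojection,
i.e. `A ≅ C ⊔ D` with `ι` the first inclusion for some `D` (in a category of countably connected
type every object is a coproduct of connected objects, §0; "`π₀(A)`, the set of connected
components of `A`", Appendix p. 79). [cite: MochizukiSemiAnbd2006, Appendix p.79] -/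
def IsComponent {C A : Q} (ι : C ⟶ A) : Prop :=
  IsConnectedObj C ∧ ∃ (D : Q) (κ : D ⟶ A), Nonempty (IsColimit (BinaryCofan.mk ι κ))

end Components

/-! ### Definition A.3: QD-pairs -/

section QDPairs

variable (Q : Type u₁) [Category.{v₁} Q]

/-- **Definition A.3 (i)** (SemiAnbd Appendix p. 81), for `Q` a connected quasi-temperoid [stated in
any category]: "Any pair `(A, Γ_A)`, where `A` is an object of `Q`, and `Γ_A ⊆ Aut_Q(A)` is a
subgroup, will be referred to as a *QD-* [or *quotient data*] *pair* [of `Q`]."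
[cite: MochizukiSemiAnbd2006, Def A.3(i) p.81] -/
structure QDPair : Type (max u₁ v₁) where
  /-- the object `A` -/
  A : Q
  /-- the subgroup `Γ_A ⊆ Aut_Q(A)` -/
  Γ : Subgroup (Aut A)

variable {Q}

namespace QDPair

/-- **Definition A.3 (i)** (p. 82): "If `Γ_A` acts transitively on `π₀(A)`, then we shall say that
this QD-pair is *weakly connected*" — transitively in the sense of a single orbit: `A` is nonempty
[as the bracketed claim of (iii), "the quotient … is connected iff the QD-pair is weakly connected",
requires] and for any two connected components `ι₁ : C₁ → A`, `ι₂ : C₂ → A` some `γ ∈ Γ_A` carries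
the first onto the second (`γ ∘ ι₁ = ι₂ ∘ e` for an isomorphism `e : C₁ ≅ C₂`).
[cite: MochizukiSemiAnbd2006, Def A.3(i) p.82] -/
def IsWeaklyConnected (P : QDPair Q) : Prop :=
  IsNonemptyObj P.A ∧
    ∀ ⦃C₁ C₂ : Q⦄ (ι₁ : C₁ ⟶ P.A) (ι₂ : C₂ ⟶ P.A), IsComponent ι₁ → IsComponent ι₂ →
      ∃ γ ∈ P.Γ, ∃ e : C₁ ≅ C₂, ι₁ ≫ γ.hom = e.hom ≫ ι₂

/-- **Definition A.3 (i)** (p. 82): "if `A` is connected, then we shall say that this QD-pair is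
*strongly connected*." [cite: MochizukiSemiAnbd2006, Def A.3(i) p.82] -/
def IsStronglyConnected (P : QDPair Q) : Prop := IsConnectedObj P.A

/-- **Definition A.3 (ii)** (p. 82): "A *morphism of QD-pairs* of `Q`, `(A, Γ_A) → (B, Γ_B)`, is
defined to be a morphism `φ : A → B` such that, for every `γ_A ∈ Γ_A`, there exists a `γ_B ∈ Γ_B`
such that `γ_B ∘ φ = φ ∘ γ_A`." [cite: MochizukiSemiAnbd2006, Def A.3(ii) p.82] -/
@[ext] structure Hom (P₁ P₂ : QDPair Q) : Type v₁ where
  /-- the arrow `φ : A → B` -/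
  hom : P₁.A ⟶ P₂.A
  /-- every `γ_A ∈ Γ_A` descends: `γ_B ∘ φ = φ ∘ γ_A` for some `γ_B ∈ Γ_B` -/
  comm : ∀ γ ∈ P₁.Γ, ∃ γ' ∈ P₂.Γ, hom ≫ γ'.hom = γ.hom ≫ hom

/-- The category `D` of QD-pairs of `Q` and morphisms of QD-pairs (proof of Thm. A.4, p. 83: "the
category whose objects are QD-pairs of `Q_i` and whose morphisms are morphisms of QD-pairs").
[cite: MochizukiSemiAnbd2006, Thm A.4 p.83] -/
instance : Category (QDPair Q) where
  Hom := Hom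
  id P := ⟨𝟙 P.A, fun γ hγ => ⟨γ, hγ, by rw [Category.id_comp, Category.comp_id]⟩⟩
  comp f g := ⟨f.hom ≫ g.hom, fun γ hγ => by
    obtain ⟨γ', hγ', h'⟩ := f.comm γ hγ
    obtain ⟨γ'', hγ'', h''⟩ := g.comm γ' hγ'
    exact ⟨γ'', hγ'', by rw [Category.assoc, h'', ← Category.assoc, h', Category.assoc]⟩⟩
  id_comp f := Hom.ext (Category.id_comp _)
  comp_id f := Hom.ext (Category.comp_id _)
  assoc f g h := Hom.ext (Category.assoc _ _ _)

/-- **Definition A.3 (ii)** (p. 82): "If, moreover, `φ` induces a surjection `π₀(A) ↠ π₀(B)`, then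
we shall say that this morphism is *0-proper*" — every connected component of `B` receives, over
`φ`, an arrow from some connected component of `A`. [cite: MochizukiSemiAnbd2006, Def A.3(ii) p.82] -/
def Hom.IsZeroProper {P₁ P₂ : QDPair Q} (f : Hom P₁ P₂) : Prop :=
  ∀ ⦃D : Q⦄ (κ : D ⟶ P₂.A), IsComponent κ →
    ∃ (C : Q) (ι : C ⟶ P₁.A) (h : C ⟶ D), IsComponent ι ∧ ι ≫ f.hom = h ≫ κ

/-- When `φ : A → B` is an epimorphism the element `γ_B` of Definition A.3 (ii) is unique ("in the
0-proper case, it follows from the fact that the category `Q` is almost totally epimorphic that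
`γ_B` is unique", p. 82; 0-proper ⇒ epimorphism is Remark A.3.1). [cite: MochizukiSemiAnbd2006, Def A.3(ii) p.82] -/
theorem Hom.existsUnique_of_epi {P₁ P₂ : QDPair Q} (f : Hom P₁ P₂) [Epi f.hom] (γ : P₁.Γ) :
    ∃! γ' : P₂.Γ, f.hom ≫ (γ' : Aut P₂.A).hom = (γ : Aut P₁.A).hom ≫ f.hom := by
  obtain ⟨γ', hγ', h⟩ := f.comm γ γ.property
  refine ⟨⟨γ', hγ'⟩, h, fun δ hδ => Subtype.ext (Aut.ext ((cancel_epi f.hom).mp ?_))⟩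
  rw [hδ, ← h]

/-- **Definition A.3 (ii)** (p. 82): "the correspondence `γ_A ↦ γ_B` determines an *associated group
homomorphism* `Γ_A → Γ_B`" — defined for `φ` an epimorphism (which makes `γ_B` unique; the paper
uses it in the 0-proper case, cf. Remark A.3.1 (a) ⇒ (b)).
[cite: MochizukiSemiAnbd2006, Def A.3(ii) p.82] -/
noncomputable def Hom.assocHom {P₁ P₂ : QDPair Q} (f : Hom P₁ P₂) [Epi f.hom] : P₁.Γ →* P₂.Γ where
  toFun γ := (f.existsUnique_of_epi γ).choose
  map_one' := (f.existsUnique_of_epi 1).unique (f.existsUnique_of_epi 1).choose_spec.1 (by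
    change f.hom ≫ (Iso.refl _).hom = (Iso.refl _).hom ≫ f.hom
    rw [Iso.refl_hom, Iso.refl_hom, Category.comp_id, Category.id_comp])
  map_mul' γ₁ γ₂ := by
    apply (f.existsUnique_of_epi (γ₁ * γ₂)).unique (f.existsUnique_of_epi (γ₁ * γ₂)).choose_spec.1
    have h₁ := (f.existsUnique_of_epi γ₁).choose_spec.1
    have h₂ := (f.existsUnique_of_epi γ₂).choose_spec.1
    change f.hom ≫ ((f.existsUnique_of_epi γ₂).choose : Aut P₂.A).hom ≫
        ((f.existsUnique_of_epi γ₁).choose : Aut P₂.A).hom =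
      ((γ₂ : Aut P₁.A).hom ≫ (γ₁ : Aut P₁.A).hom) ≫ f.hom
    rw [← Category.assoc, h₂, Category.assoc, h₁, Category.assoc]

/-- The defining property of the associated homomorphism: `φ ≫ γ_B = γ_A ≫ φ`.
[cite: MochizukiSemiAnbd2006, Def A.3(ii) p.82] -/
theorem Hom.hom_comp_assocHom {P₁ P₂ : QDPair Q} (f : Hom P₁ P₂) [Epi f.hom] (γ : P₁.Γ) :
    f.hom ≫ (f.assocHom γ : Aut P₂.A).hom = (γ : Aut P₁.A).hom ≫ f.hom :=
  (f.existsUnique_of_epi γ).choose_spec.1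

/-- **Definition A.3 (iii)** (p. 82): "Let `(A, Γ_A)` be a QD-pair. Then we shall say that an arrow
`φ : A → B` of `Q` *forms a quotient* of this QD-pair — and write `B ≅ A/Γ_A` — if the following two
properties are satisfied: (a) `φ ∘ γ_A = φ`, `∀ γ_A ∈ Γ_A`; (b) for every arrow `ψ_A : A → C`
satisfying `ψ_A ∘ γ_A = ψ_A`, `∀ γ_A ∈ Γ_A`, there exists a unique arrow `ψ_B : B → C` such that
`ψ_B ∘ φ = ψ_A`." [cite: MochizukiSemiAnbd2006, Def A.3(iii) p.82] -/
def IsQuotient (P : QDPair Q) {B : Q} (φ : P.A ⟶ B) : Prop :=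
  (∀ γ ∈ P.Γ, γ.hom ≫ φ = φ) ∧
    ∀ ⦃C : Q⦄ (ψ : P.A ⟶ C), (∀ γ ∈ P.Γ, γ.hom ≫ ψ = ψ) → ∃! ψ' : B ⟶ C, φ ≫ ψ' = ψ

/-- **Definition A.3 (iii)**, bracket (p. 82): "one verifies immediately that the quotient of a
QD-pair is unique, up to unique isomorphism, if it exists" — PROVED: two quotients are related by a
unique isomorphism under `A`. [cite: MochizukiSemiAnbd2006, Def A.3(iii) p.82] -/
theorem IsQuotient.existsUnique_iso {P : QDPair Q} {B B' : Q} {φ : P.A ⟶ B} {φ' : P.A ⟶ B'}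
    (h : P.IsQuotient φ) (h' : P.IsQuotient φ') : ∃! e : B ≅ B', φ ≫ e.hom = φ' := by
  obtain ⟨u, hu, huniq⟩ := h.2 φ' h'.1
  obtain ⟨u', hu', hu'niq⟩ := h'.2 φ h.1
  have h₁ : u ≫ u' = 𝟙 B := by
    obtain ⟨w, _, hw⟩ := h.2 φ h.1
    rw [hw (u ≫ u') (by change φ ≫ (u ≫ u') = φ; rw [← Category.assoc, hu, hu']),
      hw (𝟙 B) (Category.comp_id φ)]
  have h₂ : u' ≫ u = 𝟙 B' := by
    obtain ⟨w, _, hw⟩ := h'.2 φ' h'.1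
    rw [hw (u' ≫ u) (by change φ' ≫ (u' ≫ u) = φ'; rw [← Category.assoc, hu', hu]),
      hw (𝟙 B') (Category.comp_id φ')]
  refine ⟨⟨u, u', h₁, h₂⟩, hu, fun e he => Iso.ext (huniq e.hom he)⟩

/-- **Definition A.3 (iii)**, bracket (p. 82), named fact: in a connected quasi-temperoid "the
quotient of a QD-pair is connected if and only if the QD-pair is weakly connected".
[cite: MochizukiSemiAnbd2006, Def A.3(iii) p.82] -/
def QuotientConnectedIffWeaklyConnected : Prop :=
  ∀ (Q : Type u₁) [Category.{v₁} Q], IsConnectedQuasiTemperoid.{v₁, u₁, u} Q →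
    ∀ (P : QDPair Q) {B : Q} (φ : P.A ⟶ B), P.IsQuotient φ →
      (IsConnectedObj B ↔ P.IsWeaklyConnected)

/-- The subgroup of `γ_A ∈ Γ_A` with `φ ∘ γ_A = φ` — "`Ker(Γ_A ↠ Γ_B)`" of Definition A.3 (iv) when
`φ` is an epimorphism (`mem_stabilizer_iff_assocHom_eq_one`).
[cite: MochizukiSemiAnbd2006, Def A.3(iv) p.82] -/
def Hom.stabilizer {P₁ P₂ : QDPair Q} (f : Hom P₁ P₂) : Subgroup (Aut P₁.A) where
  carrier := {γ | γ ∈ P₁.Γ ∧ γ.hom ≫ f.hom = f.hom}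
  one_mem' := ⟨P₁.Γ.one_mem, Category.id_comp _⟩
  mul_mem' {γ δ} hγ hδ := ⟨P₁.Γ.mul_mem hγ.1 hδ.1, by
    change (δ.hom ≫ γ.hom) ≫ f.hom = f.hom
    rw [Category.assoc, hγ.2, hδ.2]⟩
  inv_mem' {γ} hγ := ⟨P₁.Γ.inv_mem hγ.1, by
    change γ.inv ≫ f.hom = f.hom
    rw [Iso.inv_comp_eq, hγ.2]⟩

/-- For `φ` an epimorphism, `γ_A ∈ Γ_A` lies in the stabiliser of `φ` iff its image under the
associated homomorphism is trivial. [cite: MochizukiSemiAnbd2006, Def A.3(iv) p.82] -/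
theorem Hom.mem_stabilizer_iff_assocHom_eq_one {P₁ P₂ : QDPair Q} (f : Hom P₁ P₂) [Epi f.hom]
    (γ : P₁.Γ) : (γ : Aut P₁.A) ∈ f.stabilizer ↔ f.assocHom γ = 1 := by
  constructor
  · rintro ⟨-, hγ⟩
    refine (f.existsUnique_of_epi γ).unique (f.hom_comp_assocHom γ) ?_
    change f.hom ≫ (Iso.refl _).hom = _
    rw [Iso.refl_hom, Category.comp_id, hγ]
  · intro h
    have h2 := f.hom_comp_assocHom γ
    rw [h] at h2
    change f.hom ≫ (Iso.refl _).hom = _ at h2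
    rw [Iso.refl_hom, Category.comp_id] at h2
    exact ⟨γ.property, h2.symm⟩

/-- **Definition A.3 (iv)** (p. 82): "A 0-proper morphism of QD-pairs of `Q`, `(A, Γ_A) → (B, Γ_B)`,
will be called *1-proper* if the associated homomorphism `Γ_A → Γ_B` is surjective, and, moreover,
the arrow `A → B` forms a quotient of the QD-pair `(A, Ker(Γ_A ↠ Γ_B))`" — choice-free rendering:
every `γ_B ∈ Γ_B` has some `γ_A ∈ Γ_A` over it, and `A → B` forms a quotient of `(A, Stab_{Γ_A}(φ))`.
[cite: MochizukiSemiAnbd2006, Def A.3(iv) p.82] -/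
def Hom.IsOneProper {P₁ P₂ : QDPair Q} (f : Hom P₁ P₂) : Prop :=
  f.IsZeroProper ∧ (∀ γ' ∈ P₂.Γ, ∃ γ ∈ P₁.Γ, f.hom ≫ γ'.hom = γ.hom ≫ f.hom) ∧
    (⟨P₁.A, f.stabilizer⟩ : QDPair Q).IsQuotient f.hom

/-- **Definition A.3 (iv)**, bracket (p. 82), named fact: "under the 1-properness assumption, one
verifies immediately that if `B → C` forms a quotient of `(B, Γ_B)`, then the composite arrow
`A → B → C` forms a quotient of `(A, Γ_A)`" (in a connected quasi-temperoid).
[cite: MochizukiSemiAnbd2006, Def A.3(iv) p.82] -/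
def OneProperCompQuotient : Prop :=
  ∀ (Q : Type u₁) [Category.{v₁} Q], IsConnectedQuasiTemperoid.{v₁, u₁, u} Q →
    ∀ (P₁ P₂ : QDPair Q) (f : Hom P₁ P₂), f.IsOneProper →
      ∀ {C : Q} (ψ : P₂.A ⟶ C), P₂.IsQuotient ψ → P₁.IsQuotient (f.hom ≫ ψ)

end QDPair

end QDPairs

/-! ### Remark A.3.1 -/

section RmkA31

/-- **Remark A.3.1** (SemiAnbd Appendix p. 82), named fact: for a morphism of QD-pairs
`(A, Γ_A) → (B, Γ_B)` of a connected quasi-temperoid "the following conditions … are equivalent: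
(a) `(A, Γ_A) → (B, Γ_B)` is 0-proper. (b) `A → B` is an epimorphism in `Q` [cf. Remark A.1.1].
(c) `B` is the colimit in `Q` of the diagram formed by the two projections `A ×_B A → A`" —
(c) rendered: `A → B` is a coequalizer of [any] kernel pair. [cite: MochizukiSemiAnbd2006, Rmk A.3.1 p.82] -/
def RmkA31 : Prop :=
  ∀ (Q : Type u₁) [Category.{v₁} Q], IsConnectedQuasiTemperoid.{v₁, u₁, u} Q →
    ∀ (P₁ P₂ : QDPair Q) (f : QDPair.Hom P₁ P₂),
      (f.IsZeroProper ↔ Epi f.hom) ∧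
      (Epi f.hom ↔ ∀ (c : PullbackCone f.hom f.hom), IsLimit c →
        Nonempty (IsColimit (Cofork.ofπ f.hom c.condition)))

end RmkA31

/-! ### Galois-countable quasi-temperoids (Comments on [SemiAnbd], May 2020, (12.) (i) (T1)) -/

section GaloisCountable

variable (Q : Type u₁) [Category.{v₁} Q]

/-- **Comments on [SemiAnbd] (May 2020), item (12.) (i) (T1)**: "We shall say that a connected
quasi-temperoid is *Galois-countable* if it arises from a Galois-countable connected temperoid" —
i.e. it admits a chart `Q ≌ B^temp(Π)[A]` with `Π` Galois-countable (second countable, the tree's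
`IsGaloisCountable`). [cite: MochizukiSemiAnbd2006, Comments (May 2020) item 12 (i) (T1)] -/
def IsGaloisCountableConnectedQuasiTemperoid : Prop :=
  ∃ c : ConnectedQuasiTemperoidChart.{v₁, u, u₁} Q, IsGaloisCountable c.G

/-- **Comments on [SemiAnbd] (May 2020), item (12.) (i) (T1)**: "We shall say that a quasi-temperoid
is *Galois-countable* if it arises from a collection of Galois-countable connected quasi-temperoids"
— i.e. it admits a chart all of whose tempered groups are Galois-countable.
[cite: MochizukiSemiAnbd2006, Comments (May 2020) item 12 (i) (T1)] -/
def IsGaloisCountableQuasiTemperoid : Prop :=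
  ∃ c : QuasiTemperoidChart.{v₁, u, u₁} Q, ∀ i, IsGaloisCountable (c.G i)

end GaloisCountable

/-! ### Theorem A.4: connected quasi-temperoids -/

section ThmA4

/-- **Theorem A.4 (Connected Quasi-temperoids)** (SemiAnbd Appendix pp. 82–83), named fact: "For
`i = 1, 2`, let `T_i` be a connected temperoid; let `A_i` be a connected object of `T_i`; write
`λ_i : Q_i := T_i[A_i] → T_i` for the natural functor. Then any morphism of quasi-temperoids
`φ : Q₁ → Q₂` fits into a 1-commutative diagram [`λ₂ ∘ φ` over `ψ ∘ λ₁`] — where the morphism of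
[quasi-]temperoids `ψ : T₁ → T₂` that makes this diagram 1-commute is unique, up to unique
isomorphism" — on underlying functors: `λ₁ ∘ φ^* ≅ ψ^* ∘ λ₂ : Q₂ ⥤ T₁` (the square produced by the
proof, p. 85), with `(ψ, ≅)` unique up to a unique compatible isomorphism.
[cite: MochizukiSemiAnbd2006, Thm A.4 pp.82-83] -/
def ThmA4 : Prop :=
  ∀ (T₁ : Type u₁) [Category.{v₁} T₁] (T₂ : Type u₂) [Category.{v₂} T₂],
    IsConnectedTemperoid.{v₁, u, u₁} T₁ → IsConnectedTemperoid.{v₂, u, u₂} T₂ →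
    ∀ (A₁ : T₁) (A₂ : T₂), IsConnectedObj A₁ → IsConnectedObj A₂ →
    ∀ φ : TemperoidHom (Over' A₁) (Over' A₂), φ.PreservesNondegenerate →
      ∃ (ψ : TemperoidHom T₁ T₂)
        (α : φ.pullback ⋙ (admitsHomTo A₁).ι ≅ (admitsHomTo A₂).ι ⋙ ψ.pullback),
        ∀ (ψ' : TemperoidHom T₁ T₂)
          (α' : φ.pullback ⋙ (admitsHomTo A₁).ι ≅ (admitsHomTo A₂).ι ⋙ ψ'.pullback),
          ∃! β : ψ.pullback ≅ ψ'.pullback, α ≪≫ (admitsHomTo A₂).ι.isoWhiskerLeft β = α'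

end ThmA4

end Literature.AnabelianGeometry.SemiGraphs
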